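import Literature.AlgebraicGeometry.Frobenioids.MonoidTransport
import Literature.AnabelianGeometry.EtaleTheta.SubmonoidPerfection
import Literature.AnabelianGeometry.EtaleTheta.PerfectionPrimes
import Literature.AnabelianGeometry.EtaleTheta.MonoprimeStructure

/-!
# The perf-saturation of a monoprime submonoid of a perfect monoid is monoprime ([EtTh] Rmk 3.6.4 input)

Source: S. Mochizuki, *The étale theta function …* [MochizukiEtTh2009], Remark 3.6.4, PDF p. 79 (printed
305): "it follows from Lemma 3.5 [applied to the submonoid `Φ ⊆ Φ^{ℝ-log}`] that the respective divisor
monoids `Φ^pf`, `Φ^rlf` of `C^pf`, `C^rlf` also satisfy the conditions of Definition 3.6, (ii)" — in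
particular condition (a): the base-field part of `Φ^pf`, i.e. the perf-saturation (§0) of the monoprime
monoid `Φ^{bs-fld}(A)` inside the perfect monoid `Φ^{ℝ-log}(A)`, is again monoprime. This file proves the
monoid-theoretic content, stub-free:

* `nonempty_perfection_mulEquiv_perfSaturation`: for `Q` perfect and any submonoid `P ⊆ Q`,
  `P^pf ≅ perfSaturation P` (Lemma 3.5 (i), `P^pf` portion: `SubmonoidPerfection.lean`, seat abc-iut-L6-t12);
* `isMonoprime_perfSaturation`: if `P` is monoprime then so is its perf-saturation
  (`(ℤ_{≥0})^pf ≅ ℚ_{≥0}`, …: `PerfectionPrimes.isMonoprime_perfection`);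
* `isPerfFactorial_perfSaturation`: hence the perf-saturation is perf-factorial
  (`MonoprimeStructure.isPerfFactorial`).

Proof-only (no definitions). Seat abc-iut-L2-d2 (cell abc-iut; input for the discharge of the §3
statement file's `Remark364`, conjunct 3, once its `cnstR` carries the printed `ℝ`-subspace structure —
audit of p407532, finding F2).
-/

namespace Literature.AnabelianGeometry.EtaleTheta

namespace Lemma35

open Literature.AlgebraicGeometry.Frobenioids Function

universe u

variable {Q : Type u} [CommMonoid Q]

/-- For `Q` perfect and any submonoid `P ⊆ Q`: `P^pf ≅ P^pf ∩ Q` (the perf-saturation of §0) — the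
inclusion `P^pf ↪ Q` of Lemma 3.5 (i) is injective with image the perf-saturation.
[cite: MochizukiEtTh2009, Lem 3.5 p.75] -/
theorem nonempty_perfection_mulEquiv_perfSaturation (hQ : IsPerfect Q) (P : Submonoid Q) :
    Nonempty (Perfection P ≃* ↥(perfSaturation P)) := by
  obtain ⟨ι, hι⟩ := exists_extension P hQ
  have hinj : Injective ι := extension_injective ι hι
  have hr : MonoidHom.mrange ι = perfSaturation P := mrange_extension_eq_perfSaturation hQ ι hι
  have hbij : Bijective ι.mrangeRestrict :=
    ⟨fun x y h => hinj (congrArg Subtype.val h), MonoidHom.mrangeRestrict_surjective ι⟩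
  exact ⟨(MulEquiv.ofBijective ι.mrangeRestrict hbij).trans (MulEquiv.submonoidCongr hr)⟩

/-- **The perf-saturation of a monoprime submonoid of a perfect monoid is monoprime** (the
monoid-theoretic content of [EtTh] Rmk 3.6.4, condition (a) of Def 3.6 (ii) for `Φ^pf`).
[cite: MochizukiEtTh2009, Rmk 3.6.4 p.79] -/
theorem isMonoprime_perfSaturation (hQ : IsPerfect Q) {P : Submonoid Q} (hP : IsMonoprime P) :
    IsMonoprime ↥(perfSaturation P) := by
  obtain ⟨e⟩ := nonempty_perfection_mulEquiv_perfSaturation hQ P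
  exact PerfectionPrimes.isMonoprime_of_mulEquiv e (PerfectionPrimes.isMonoprime_perfection hP)

/-- Hence the perf-saturation of a monoprime submonoid of a perfect monoid is perf-factorial.
[cite: MochizukiEtTh2009, Rmk 3.6.4 p.79] -/
theorem isPerfFactorial_perfSaturation (hQ : IsPerfect Q) {P : Submonoid Q} (hP : IsMonoprime P) :
    IsPerfFactorial ↥(perfSaturation P) :=
  MonoprimeStructure.isPerfFactorial (isMonoprime_perfSaturation hQ hP)

/-- The perf-saturation of a submonoid of a perfect monoid is perfect ("`P^pf` is always perfect",
[FrdI] §0, transported). [cite: MochizukiEtTh2009, Lem 3.5 p.75] -/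
theorem isPerfect_perfSaturation (hQ : IsPerfect Q) (P : Submonoid Q) : IsPerfect ↥(perfSaturation P) := by
  obtain ⟨e⟩ := nonempty_perfection_mulEquiv_perfSaturation hQ P
  exact IsPerfect.of_mulEquiv e isPerfect_perfection

end Lemma35

end Literature.AnabelianGeometry.EtaleTheta
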